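import Literature.AlgebraicGeometry.Resolution.GeneratorDeepCentres
import HarnessLib

/-!
# The split disc of the generator: unit form of `P′` and the Hensel polynomial of the disc coordinate

Topic: `Literature/AlgebraicGeometry/Resolution` (valued function fields). Companion of
`GeneratorDeepCentres.lean` (`exists_disc_constants_charP`: a centre `a`, a radius `c` and the
minimal polynomial `P` of `a` over the henselian constants, with `|x − a| < |c| < |a − ρ|` for all
roots `ρ ≠ a` of `P` — the disc `|X − a| ≤ |c|` through the generator `x` is SPLIT for its
centre, Temkin 2013, Lemma 3.1.3) for the algebraization step of M. Temkin, *Inseparable local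
uniformization*, J. Algebra 373 (2013), Thm. 3.3.1 (tree: `Temkin2013RelativeCurveSmoothFibre`,
reduced to chart data by `DChartRoof.lean`). On a split disc the centre is realised on the
`K`-side chart WITHOUT approximants from the function field: the disc coordinate
`x′ = (x − a)/c` itself is a simple Hensel root of an explicit polynomial over the ring generated
by `x`, `c` and the coefficients of `P`, and `a = x − c·x′`. This file proves the two polynomial
facts behind this:

* `exists_unitForms_of_split_root` — **unit forms of `P/(X − a)` and of `P′` at `(a, c)`**:
  `P(y) = (y − a)·P′(a)·U(x′)`, `P′(y) = P′(a)·(U + X U′)(x′)` with `1`-unit polynomials over the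
  field of the data; hence `|P′(y)| = |P′(a)|` on the disc and the roots of `P′` are at distance
  `> |c|` from `a` — PROVED;
* `henselPoly_discCoordinate` — **the Hensel polynomial of the disc coordinate**: for `x` in the
  disc, `H(S) = P(x − cS)/(−c·P′(x))` satisfies `H(x′) = 0`, has linear coefficient `1`,
  constant coefficient of value `|x′| ≤ 1`, higher coefficients of value `< 1` (its reduction is
  LINEAR), `|H′(x′)| = 1`, and all its other roots have value `> 1` — PROVED
  (`H = h₀·(S − x′)·W(S)`, `W` a `1`-unit polynomial, `|h₀| = 1`).

Both hold verbatim for every valuation ring for which the hypotheses hold (they are stated for an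
arbitrary `V`), which is how a consumer proves that the coefficients of `H` lie in a normal chart
ring (valuative membership over the cut disc). All statements are [folklore]; no definitions, no
named facts.

## Sources

* M. Temkin, arXiv:0804.1554v3, Lemma 3.1.3 and the proof of Thm. 3.3.1, Step 3 (the use).
  [Temkin2013]
-/

noncomputable section

open Polynomial IsLocalRing

namespace Literature.AlgebraicGeometry.Resolution

universe u

variable {Ω : Type u} [Field Ω] (V : ValuationSubring Ω)

/-! ### The split disc: unit form of `P′` and the Hensel polynomial of the disc coordinate -/

section SplitDisc

variable [IsAlgClosed Ω]

omit [IsAlgClosed Ω] in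
/-- Division by `X − a` preserves coefficientwise membership in a subfield containing `a`.
[folklore] -/
theorem coeff_divByMonic_X_sub_C_mem (m : Subfield Ω) {a : Ω} (ham : a ∈ m) {P : Polynomial Ω}
    (hPm : ∀ i, P.coeff i ∈ m) (i : ℕ) : (P /ₘ (X - C a)).coeff i ∈ m := by
  obtain ⟨Pm, hPm'⟩ : ∃ Pm : Polynomial m, Pm.map (algebraMap m Ω) = P :=
    (Polynomial.mem_lifts P).mp ((Polynomial.lifts_iff_coeff_lifts P).mpr fun j =>
      ⟨⟨P.coeff j, hPm j⟩, rfl⟩)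
  have hmon : (X - C (⟨a, ham⟩ : m) : Polynomial m).Monic := monic_X_sub_C _
  have h : (Pm /ₘ (X - C (⟨a, ham⟩ : m))).map (algebraMap m Ω) = P /ₘ (X - C a) := by
    rw [Polynomial.map_divByMonic _ hmon, hPm']
    congr 1
    rw [Polynomial.map_sub, map_X, map_C]; rfl
  rw [← h, coeff_map]
  exact ((Pm /ₘ (X - C (⟨a, ham⟩ : m))).coeff i).2

/-- **The split disc, I: unit forms of `P/(X − a)` and of `P′`.** Let `P` be a polynomial over
`m` with a SIMPLE root `a ∈ m` (`P(a) = 0`, `P′(a) ≠ 0`) and let `c ∈ m`, `c ≠ 0`, be such that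
every other root `ρ` of `P` has `|c| < |a − ρ|` (the disc `|X − a| ≤ |c|` is split for the root
`a`). Then with `x′ = (y − a)/c`: `P(y) = (y − a) · P′(a) · U(x′)` and `P′(y) = P′(a) · Ũ(x′)` for
`1`-unit polynomials `U`, `Ũ = U + X U′` over `m`. Consequently `|P′(y)| = |P′(a)|` on the disc and
the roots of `P′` lie at distance `> |c|` from `a`. [folklore] -/
theorem exists_unitForms_of_split_root (m : Subfield Ω) {a c : Ω} (ham : a ∈ m) (hcm : c ∈ m)
    (hc0 : c ≠ 0) {P : Polynomial Ω} (hPm : ∀ i, P.coeff i ∈ m) (hPa : P.eval a = 0)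
    (hPa' : (derivative P).eval a ≠ 0)
    (hfar : ∀ ρ : Ω, P.IsRoot ρ → ρ ≠ a → V.valuation c < V.valuation (a - ρ)) :
    ∃ U : Polynomial Ω, (∀ i, U.coeff i ∈ m) ∧ U.coeff 0 = 1 ∧
      (∀ i, 1 ≤ i → V.valuation (U.coeff i) < 1) ∧
      (∀ y : Ω, P.eval y = (y - a) * (derivative P).eval a * U.eval ((y - a) / c)) ∧
      (∀ i, (U + X * derivative U).coeff i ∈ m) ∧ (U + X * derivative U).coeff 0 = 1 ∧
      (∀ i, 1 ≤ i → V.valuation ((U + X * derivative U).coeff i) < 1) ∧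
      (∀ y : Ω, (derivative P).eval y =
        (derivative P).eval a * (U + X * derivative U).eval ((y - a) / c)) ∧
      (∀ y : Ω, V.valuation (y - a) ≤ V.valuation c →
        V.valuation ((derivative P).eval y) = V.valuation ((derivative P).eval a)) ∧
      (∀ ρ' : Ω, (derivative P).IsRoot ρ' → V.valuation c < V.valuation (a - ρ')) := by
  -- `P = (X − a) Q`, `Q(a) = P′(a) ≠ 0`
  set Q : Polynomial Ω := P /ₘ (X - C a) with hQ
  have hPQ : (X - C a) * Q = P := mul_divByMonic_eq_iff_isRoot.mpr hPa
  have hQm : ∀ i, Q.coeff i ∈ m := coeff_divByMonic_X_sub_C_mem m ham hPm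
  have hderiv : derivative P = Q + (X - C a) * derivative Q := by
    conv_lhs => rw [← hPQ]
    rw [derivative_mul, derivative_sub, derivative_X, derivative_C, sub_zero, one_mul]
  have hQa : Q.eval a = (derivative P).eval a := by
    rw [hderiv, eval_add, eval_mul, eval_sub, eval_X, eval_C, sub_self, zero_mul, add_zero]
  have hfarQ : ∀ ρ : Ω, Q.IsRoot ρ → V.valuation c < V.valuation (a - ρ) := by
    intro ρ hρ
    have hPρ : P.IsRoot ρ := by
      rw [← hPQ, IsRoot.def, eval_mul, hρ.eq_zero, mul_zero]
    refine hfar ρ hPρ fun h => hPa' ?_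
    rw [← hQa, ← h]; exact hρ
  -- unit form of `Q`
  obtain ⟨hQa0, U, hUm, hU0, hUk, hUeval⟩ := exists_unitForm_of_forall_isRoot V m ham hcm hc0 hQm hfarQ
  have hPeval : ∀ y : Ω, P.eval y = (y - a) * (derivative P).eval a * U.eval ((y - a) / c) := by
    intro y
    rw [← hQa, mul_assoc, ← hUeval y, ← hPQ, eval_mul, eval_sub, eval_X, eval_C]
  -- `Q` as a polynomial: `Q = Q(a) · U((X − a)/c)`
  set q : Polynomial Ω := C c⁻¹ * (X - C a) with hq
  have hqeval : ∀ y, q.eval y = (y - a) / c := fun y => by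
    rw [hq, eval_mul, eval_C, eval_sub, eval_X, eval_C, div_eq_inv_mul]
  have hQpoly : Q = C (Q.eval a) * U.comp q := by
    refine Polynomial.funext fun y => ?_
    rw [eval_mul, eval_C, eval_comp, hqeval, hUeval y]
  have hq' : derivative q = C c⁻¹ := by
    rw [hq, derivative_mul, derivative_C, zero_mul, zero_add, derivative_sub, derivative_X,
      derivative_C, sub_zero, mul_one]
  have hQ' : derivative Q = C (Q.eval a) * (derivative q * (derivative U).comp q) := by
    conv_lhs => rw [hQpoly]
    rw [derivative_mul, derivative_C, zero_mul, zero_add, derivative_comp]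
  have hQ'eval : ∀ y, (derivative Q).eval y = Q.eval a * (c⁻¹ * (derivative U).eval ((y - a) / c)) := by
    intro y
    rw [hQ', hq', eval_mul, eval_C, eval_mul, eval_C, eval_comp, hqeval]
  -- the `1`-unit polynomial `Ũ = U + X U′`
  set Ut : Polynomial Ω := U + X * derivative U with hUt
  have hUtcoef : ∀ i, Ut.coeff i = U.coeff i * ((i : Ω) + 1) := by
    intro i
    rw [hUt, coeff_add]
    rcases Nat.eq_zero_or_pos i with rfl | hi
    · rw [mul_comm X, coeff_mul_X_zero, Nat.cast_zero, zero_add, mul_one, add_zero]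
    · obtain ⟨j, rfl⟩ : ∃ j, i = j + 1 := ⟨i - 1, by omega⟩
      rw [mul_comm X, coeff_mul_X, coeff_derivative]
      push_cast; ring
  have hUtm : ∀ i, Ut.coeff i ∈ m := fun i => by
    rw [hUtcoef]
    exact m.mul_mem (hUm i) (m.add_mem (by exact_mod_cast natCast_mem m i) m.one_mem)
  have hUt0 : Ut.coeff 0 = 1 := by rw [hUtcoef, hU0, Nat.cast_zero, zero_add, mul_one]
  have hUtk : ∀ i, 1 ≤ i → V.valuation (Ut.coeff i) < 1 := by
    intro i hi
    rw [hUtcoef, map_mul]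
    have hn : V.valuation ((i : Ω) + 1) ≤ 1 := by
      rw [V.valuation_le_one_iff]
      exact_mod_cast natCast_mem V (i + 1)
    calc V.valuation (U.coeff i) * V.valuation ((i : Ω) + 1)
        ≤ V.valuation (U.coeff i) * 1 := mul_le_mul_right hn _
      _ < 1 := by rw [mul_one]; exact hUk i hi
  have hP'eval : ∀ y : Ω, (derivative P).eval y = (derivative P).eval a * Ut.eval ((y - a) / c) := by
    intro y
    rw [← hQa, hderiv, eval_add, eval_mul, eval_sub, eval_X, eval_C, hUeval y, hQ'eval y, hUt,
      eval_add, eval_mul, eval_X, div_eq_mul_inv]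
    ring
  have hP'val : ∀ y : Ω, V.valuation (y - a) ≤ V.valuation c →
      V.valuation ((derivative P).eval y) = V.valuation ((derivative P).eval a) := by
    intro y hy
    have hx'V : (y - a) / c ∈ V := by
      rw [← V.valuation_le_one_iff, map_div₀]; exact div_le_one_of_le₀ hy zero_le
    rw [hP'eval y, map_mul, valuation_eval_unitForm_eq_one V m hUtm hUt0 hUtk V (fun _ _ => Iff.rfl) hx'V,
      mul_one]
  refine ⟨U, hUm, hU0, hUk, hPeval, hUtm, hUt0, hUtk, hP'eval, hP'val, fun ρ' hρ' => ?_⟩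
  by_contra hle
  push Not at hle
  have h := hP'val ρ' (by rw [Valuation.map_sub_swap]; exact hle)
  rw [hρ'.eq_zero, map_zero] at h
  exact hPa' ((map_eq_zero _).mp h.symm)

/-- **The split disc, II: the Hensel polynomial of the disc coordinate.** In the situation of
`exists_unitForms_of_split_root`, let moreover `x` lie in the disc, `|x − a| ≤ |c|`, and put
`x′ = (x − a)/c`, `H(S) = P(x − cS)/(−c·P′(x))` (a polynomial in `S` over `m(x)`, normalised by
its linear coefficient). Then `P′(x) ≠ 0`, `H(x′) = 0`, `H` has linear coefficient `1`, constant
coefficient of value `|x′| ≤ 1`, all higher coefficients of value `< 1`, `|H′(x′)| = 1`, and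
every other root `s` of `H` has `|s| > 1`: the reduction of `H` is LINEAR, so `x′` — and with it
the centre `a = x − c x′` — is a simple Hensel root over any ring containing `x, c` and the
coefficients of `P` in which the coefficients of `H` lie (they have value `≤ 1` at every valuation
for which the hypotheses hold). (`H = (S − x′) · h₀ · W(S)`, `W` a `1`-unit polynomial, `|h₀| = 1`.)
[cite: Temkin2013, Lemma 3.1.3 with Thm. 3.3.1 (proof, Step 3)] -/
theorem henselPoly_discCoordinate {a c x : Ω} (hc0 : c ≠ 0) {P : Polynomial Ω}
    (hPa : P.eval a = 0) (hPa' : (derivative P).eval a ≠ 0)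
    (hfar : ∀ ρ : Ω, P.IsRoot ρ → ρ ≠ a → V.valuation c < V.valuation (a - ρ))
    (hxa : V.valuation (x - a) ≤ V.valuation c) :
    (derivative P).eval x ≠ 0 ∧
    V.valuation ((derivative P).eval x) = V.valuation ((derivative P).eval a) ∧
    let H : Polynomial Ω := P.comp (C x - C c * X) * C (-c * (derivative P).eval x)⁻¹
    H.eval ((x - a) / c) = 0 ∧ H.coeff 1 = 1 ∧
    V.valuation (H.coeff 0) = V.valuation ((x - a) / c) ∧ V.valuation ((x - a) / c) ≤ 1 ∧
    (∀ j, 2 ≤ j → V.valuation (H.coeff j) < 1) ∧ (∀ j, V.valuation (H.coeff j) ≤ 1) ∧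
    V.valuation ((derivative H).eval ((x - a) / c)) = 1 ∧
    (∀ s : Ω, H.IsRoot s → s ≠ (x - a) / c → 1 < V.valuation s) := by
  -- unit forms (over the subfield `⊤`, no rationality needed here)
  obtain ⟨U, -, hU0, hUk, hPeval, -, hUt0, hUtk, hP'eval, hP'val, -⟩ :=
    exists_unitForms_of_split_root V (⊤ : Subfield Ω) (Subfield.mem_top a) (Subfield.mem_top c) hc0
      (P := P) (fun _ => Subfield.mem_top _) hPa hPa' hfar
  have hP'x : V.valuation ((derivative P).eval x) = V.valuation ((derivative P).eval a) := hP'val x hxa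
  have hP'x0 : (derivative P).eval x ≠ 0 := fun h0 => by
    rw [h0, map_zero] at hP'x; exact hPa' ((map_eq_zero _).mp hP'x.symm)
  refine ⟨hP'x0, hP'x, ?_⟩
  set x' : Ω := (x - a) / c with hx'
  set d : Ω := -c * (derivative P).eval x with hd
  have hd0 : d ≠ 0 := mul_ne_zero (neg_ne_zero.mpr hc0) hP'x0
  set q : Polynomial Ω := C x - C c * X with hq
  set H : Polynomial Ω := P.comp q * C d⁻¹ with hH
  have hqeval : ∀ s, q.eval s = x - c * s := fun s => by
    rw [hq, eval_sub, eval_C, eval_mul, eval_C, eval_X]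
  have hHeval : ∀ s, H.eval s = P.eval (x - c * s) * d⁻¹ := fun s => by
    rw [hH, eval_mul, eval_C, eval_comp, hqeval]
  have hx'V : V.valuation x' ≤ 1 := by
    rw [hx', map_div₀]; exact div_le_one_of_le₀ hxa zero_le
  -- `H(x′) = 0`
  have hHx' : H.eval x' = 0 := by
    rw [hHeval, hx', mul_div_cancel₀ _ hc0, sub_sub_cancel, hPa, zero_mul]
  -- the linear coefficient of `H` is `1`
  have hH1 : H.coeff 1 = 1 := by
    have h1 : H.coeff 1 = (derivative H).eval 0 := by
      rw [← coeff_zero_eq_eval_zero, coeff_derivative]; simp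
    rw [h1, hH, derivative_mul, derivative_C, mul_zero, add_zero, derivative_comp, eval_mul, eval_mul,
      eval_C, eval_comp, hqeval, mul_zero, sub_zero]
    rw [hq, derivative_sub, derivative_C, zero_sub, derivative_mul, derivative_C, zero_mul, zero_add,
      derivative_X, mul_one, eval_neg, eval_C, hd]
    field_simp
  -- the roots of `H`: `x′` (simple) and the `(x − ρ)/c`, `ρ ≠ a`, of value `> 1`
  have hHroots : ∀ s : Ω, H.IsRoot s → s ≠ x' → 1 < V.valuation s := by
    intro s hs hsx'
    rw [IsRoot.def, hHeval, mul_eq_zero] at hs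
    rcases hs with hs | hs
    · have hρa : x - c * s ≠ a := fun h => hsx' (by
        rw [hx', eq_div_iff hc0]; linear_combination (-1 : Ω) * h)
      have h1 := hfar (x - c * s) hs hρa
      -- `a − (x − c s) = c s − (x − a)`, of value `> |c| ≥ |x − a|`, hence `= |c s|`
      have heq : a - (x - c * s) = c * s - (x - a) := by ring
      rw [heq] at h1
      have hcs : V.valuation c < V.valuation (c * s) := by
        by_contra hle
        push Not at hle
        have : V.valuation (c * s - (x - a)) ≤ V.valuation c :=
          (Valuation.map_sub _ _ _).trans (max_le hle hxa)
        exact absurd h1 (not_lt.mpr this)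
      rw [map_mul] at hcs
      have hvc : 0 < V.valuation c := zero_lt_iff.mpr ((_root_.map_ne_zero _).mpr hc0)
      calc (1 : V.ValueGroup) = V.valuation c * (V.valuation c)⁻¹ := (mul_inv_cancel₀ hvc.ne').symm
        _ < V.valuation c * V.valuation s * (V.valuation c)⁻¹ := mul_lt_mul_of_pos_right hcs (inv_pos.mpr hvc)
        _ = V.valuation s := by rw [mul_comm (V.valuation c), mul_assoc, mul_inv_cancel₀ hvc.ne', mul_one]
    · exact absurd hs (inv_ne_zero hd0)
  -- `H′(x′) = P′(a)/P′(x)` has value `1`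
  have hH'x' : (derivative H).eval x' = (derivative P).eval a / (derivative P).eval x := by
    rw [hH, derivative_mul, derivative_C, mul_zero, add_zero, derivative_comp, eval_mul, eval_mul, eval_comp,
      hqeval, hx', mul_div_cancel₀ _ hc0, sub_sub_cancel]
    rw [hq, derivative_sub, derivative_C, zero_sub, derivative_mul, derivative_C, zero_mul, zero_add,
      derivative_X, mul_one, eval_neg, eval_C, eval_C, hd]
    field_simp
  have hvH'x' : V.valuation ((derivative H).eval x') = 1 := by
    rw [hH'x', map_div₀, hP'x, div_self]
    exact (_root_.map_ne_zero _).mpr hPa'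
  have hH'x'0 : (derivative H).eval x' ≠ 0 := fun h0 => by
    rw [h0, map_zero] at hvH'x'; exact zero_ne_one hvH'x'
  -- `H = (X − x′) · H₁`, `H₁` with all roots of value `> 1`
  set H₁ : Polynomial Ω := H /ₘ (X - C x') with hH₁
  have hHH₁ : (X - C x') * H₁ = H := mul_divByMonic_eq_iff_isRoot.mpr hHx'
  have hH₁x' : H₁.eval x' = (derivative H).eval x' := by
    conv_rhs => rw [← hHH₁]
    rw [derivative_mul, derivative_sub, derivative_X, derivative_C, sub_zero, one_mul, eval_add, eval_mul,
      eval_sub, eval_X, eval_C, sub_self, zero_mul, add_zero]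
  have hH₁roots : ∀ s : Ω, H₁.IsRoot s → 1 < V.valuation s := by
    intro s hs
    have hHs : H.IsRoot s := by rw [← hHH₁, IsRoot.def, eval_mul, hs.eq_zero, mul_zero]
    refine hHroots s hHs fun h => hH'x'0 ?_
    rw [← hH₁x', ← h]; exact hs
  have hh₀ : H₁.coeff 0 ≠ 0 := fun h0 => by
    have : H₁.IsRoot 0 := by rw [IsRoot.def, ← coeff_zero_eq_eval_zero, h0]
    have h1 := hH₁roots 0 this
    rw [map_zero] at h1
    exact not_lt_zero h1
  set h₀ : Ω := H₁.coeff 0 with hh₀def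
  -- coefficients of `(X − x′) · R`
  have hcoefXW : ∀ (R : Polynomial Ω) (j : ℕ), ((X - C x') * R).coeff (j + 1) = R.coeff j - x' * R.coeff (j + 1) := by
    intro R j
    rw [sub_mul, coeff_sub, mul_comm X, coeff_mul_X, coeff_C_mul]
  have hcoefXW0 : ∀ R : Polynomial Ω, ((X - C x') * R).coeff 0 = -(x' * R.coeff 0) := by
    intro R
    rw [sub_mul, coeff_sub, mul_comm X, coeff_mul_X_zero, coeff_C_mul, zero_sub]
  -- `W = h₀⁻¹ H₁` is a `1`-unit polynomial
  set W : Polynomial Ω := C h₀⁻¹ * H₁ with hW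
  have hW0 : W.coeff 0 = 1 := by rw [hW, coeff_C_mul, ← hh₀def, inv_mul_cancel₀ hh₀]
  have hWroots : ∀ s : Ω, W.IsRoot s → 1 < V.valuation s := by
    intro s hs
    rw [IsRoot.def, hW, eval_mul, eval_C, mul_eq_zero] at hs
    rcases hs with hs | hs
    · exact absurd hs (inv_ne_zero hh₀)
    · exact hH₁roots s hs
  have hWk := oneUnit_of_forall_isRoot V W.natDegree W le_rfl hW0 hWroots
  have hWle : ∀ i, V.valuation (W.coeff i) ≤ 1 := fun i => by
    rcases Nat.eq_zero_or_pos i with rfl | hi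
    · rw [hW0, map_one]
    · exact (hWk i hi).le
  -- `H = (X − x′) · h₀ · W`; coefficients
  have hH₁W : H₁ = C h₀ * W := by
    rw [hW, ← mul_assoc, ← C_mul, mul_inv_cancel₀ hh₀, C_1, one_mul]
  have hHfac : H = C h₀ * ((X - C x') * W) := by
    rw [← hHH₁, hH₁W]; ring
  -- `h₀ (1 − x′ W₁) = H.coeff 1 = 1`, so `|h₀| = 1`
  have hvh₀ : V.valuation h₀ = 1 := by
    have h := hH1
    rw [hHfac, coeff_C_mul, hcoefXW W 0, hW0] at h
    have hunit : V.valuation (1 - x' * W.coeff 1) = 1 := by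
      rw [Valuation.map_one_sub_of_lt]
      rw [map_mul]
      calc V.valuation x' * V.valuation (W.coeff 1) ≤ 1 * V.valuation (W.coeff 1) :=
            mul_le_mul_left hx'V _
        _ < 1 := by rw [one_mul]; exact hWk 1 le_rfl
    have := congrArg V.valuation h
    rw [map_mul, hunit, mul_one, map_one] at this
    exact this
  have hHcoef0 : V.valuation (H.coeff 0) = V.valuation x' := by
    rw [hHfac, coeff_C_mul, hcoefXW0 W, map_mul, hvh₀, one_mul, Valuation.map_neg, map_mul, hW0, map_one,
      mul_one]
  have hHcoefj : ∀ j, 2 ≤ j → V.valuation (H.coeff j) < 1 := by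
    intro j hj
    obtain ⟨i, rfl⟩ : ∃ i, j = i + 1 := ⟨j - 1, by omega⟩
    rw [hHfac, coeff_C_mul, hcoefXW W i, map_mul, hvh₀, one_mul]
    refine lt_of_le_of_lt (Valuation.map_sub _ _ _) (max_lt (hWk i (by omega)) ?_)
    rw [map_mul]
    calc V.valuation x' * V.valuation (W.coeff (i + 1)) ≤ 1 * V.valuation (W.coeff (i + 1)) :=
          mul_le_mul_left hx'V _
      _ < 1 := by rw [one_mul]; exact hWk (i + 1) (by omega)
  have hHcoef_le : ∀ j, V.valuation (H.coeff j) ≤ 1 := by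
    intro j
    rcases Nat.lt_or_ge j 2 with hj | hj
    · interval_cases j
      · rw [hHcoef0]; exact hx'V
      · rw [hH1, map_one]
    · exact (hHcoefj j hj).le
  exact ⟨hHx', hH1, hHcoef0, hx'V, hHcoefj, hHcoef_le, hvH'x', hHroots⟩

end SplitDisc

end Literature.AlgebraicGeometry.Resolution

end
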